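import Mathlib
import HarnessLib
import Summits.Langlands.Langlands.Theses.SkinnerWilesDefectOne
import Summits.Langlands.Langlands.Theorems.ReducibleOrdinaryProModular.Negative.LevelAndRamification
import Summits.Langlands.Langlands.Theorems.SkinnerWilesDefectOneReducibleOrdinaryProModularDefs
import Literature.NumberTheory.GaloisRepresentations.NearlyOrdinaryDeformationRing
import Literature.NumberTheory.Automorphic.ChebotarevArtinRepHolds
import Literature.NumberTheory.GaloisRepresentations.CyclotomicCharacterFrobeniusProofs
import Literature.NumberTheory.GaloisRepresentations.GaloisRepFrobeniusProofs

/-!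
# Čebotarev supply of a Taylor–Steinberg place off a thin set: stub `stub_chebotarevSupply` of line
# steinberg-hyperplane (crux `ReducibleOrdinaryProModular`, stmt-Langlands-12919)

Route `SkinnerWilesDefectOne`, crux `Summit.Langlands.Langlands.Theses.SkinnerWilesDefectOne.ReducibleOrdinaryProModular`,
line `steinberg-hyperplane`, registered stub S1.  Vocabulary (`IsThin`, `chebotarevWindow`, `ResTrivial`,
`CycloTrivialModP`, `TaylorSteinbergPlace`, `FrobAvoids`) from
`Theorems/SkinnerWilesDefectOneReducibleOrdinaryProModularDefs.lean`.

**Statement proved** (`stub_chebotarevSupply`, registered signature verbatim).  For a number field `F`, a prime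
`p`, a framed `p`-adic representation `ρ` of `Γ_F` unramified almost everywhere, an integral model
`ρ₀ : Γ_F → GL₂(O)` and a set `B ⊆ Γ_F` which is *thin* for `ρ₀` (`IsThin p ρ₀ B`: a union of cosets of an
open normal subgroup `N` of the Čebotarev window `G₀ = {τ | ρ₀ τ ≡ 1 mod 𝔪_O, χ_p(τ) ≡ 1 mod p}`, stable under
conjugation, missing a whole coset `τ N ⊆ G₀`), there is a finite place `v₀ ∤ p` of `F` with `ρ` unramified at
`v₀`, `N v₀ ≡ 1 (mod p)`, every arithmetic Frobenius at every prime of `ℤ̄_F` above `v₀` residually trivial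
for `ρ₀` (`TaylorSteinbergPlace p ρ ρ₀ v₀`) and outside `B` (`FrobAvoids B v₀`).  (The remaining hypotheses of
the registered signature — `F` imaginary quadratic, `p` odd, `O = 𝒪_{ℚ̄_p}`-valuation ring, irreducibility,
the integral model and the ordinary local clause `OrdLoc` — are not used.)

**Mechanism.**
1. `exists_framedArtinRep_apply_eq_iff`: the regular permutation representation of the finite group
   `Γ_F ⧸ N` (`N` open, `Γ_F` compact: Mathlib `Subgroup.quotient_finite_of_isOpen`), inflated to `Γ_F`, is an
   Artin representation `σ_N` with `σ_N φ = σ_N g ↔ g⁻¹ φ ∈ N` (pattern of the tree's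
   `absoluteGaloisGroup.exists_framedArtinRep_restrictNormalHom_eq`, `FrobeniusDensity.lean`).
2. Chebotarev's density theorem in existence form for Artin representations, PROVED in the tree
   (`Literature.NumberTheory.Automorphic.chebotarev_artinRep_holds`), applied to `σ_N` and `τ`: infinitely many
   places `v` with `σ_N` unramified at `v` carrying a Frobenius `φ` with `σ_N φ = σ_N τ`, i.e. `φ ∈ τ N`; discard
   the finitely many `v ∣ p` (`Ideal.finite_factors`) and the finitely many places where `ρ` ramifies (`hunr`).
3. All Frobenii at `v₀` are then conjugate into `τ N`: primes above `v₀` are `Γ_F`-conjugate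
   (`HeightOneSpectrum.exists_smul_eq_of_mem_primesAbove_holds`), Frobenii at one prime agree up to inertia
   (Mathlib `IsArithFrobAt.conj`, `IsArithFrobAt.mul_inv_mem_inertia`), and inertia at `v₀` lies in
   `ker σ_N = N`.
4. `τ N ⊆ G₀`; residual triviality is a kernel condition, hence conjugation invariant (`resTrivial_conj`), so
   every Frobenius at `v₀` is residually trivial; the Frobenius `φ ∈ τ N ⊆ G₀` found in step 2 is trivial on
   `μ_p`, which reads `N v₀ ≡ 1 (mod p)` by the PROVED `GaloisRep.cyclotomicCharacter_apply_of_isArithFrobAt`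
   (`χ_p(Frob_v) = N v` for `v ∤ p`) and `PadicInt.ker_toZMod`; `B` conjugation-stable and `τ N ∩ B = ∅` give
   `FrobAvoids`.

References: J. Tate, *Global class field theory*, in Cassels–Fröhlich (1967), Ch. VII §2.4 (Tchebotarev
density theorem) [TateGCFT1967]; J.-P. Serre, *Abelian ℓ-adic representations and elliptic curves* (1968),
Ch. I §2.1–2.2 [SerreAbelianLadic1968]; R. Taylor, *Automorphy for some l-adic lifts of automorphic mod l
Galois representations II* (2008) (Taylor–Steinberg auxiliary places, `N v ≡ 1 mod p`, `ρ̄(Frob_v) = 1`).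
-/

set_option linter.dupNamespace false
set_option autoImplicit false

namespace Summit.Langlands.Langlands.Cruxes.ReducibleOrdinaryProModular.SteinbergHyperplane

open scoped NumberField MatrixGroups
open Filter NumberField IsDedekindDomain Field Polynomial Matrix
open Literature.NumberTheory.Automorphic Literature.NumberTheory.Automorphic.BigHeckeGLn
open Literature.NumberTheory.GaloisRepresentations
open Summit.Langlands.Langlands.Theses.SkinnerWilesDefectOne

noncomputable section

/-! ### A faithful Artin representation of a finite quotient `Γ_F ⧸ N` -/

/-- **The regular Artin representation of `Γ_F ⧸ N`.**  For an open normal subgroup `N` of `Γ_F` there is an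
Artin representation `σ : Γ_F → GL_n(ℂ)` with `σ φ = σ g ↔ g⁻¹ φ ∈ N` (so `ker σ = N`): the regular permutation
representation of the finite group `Q = Γ_F ⧸ N` (`N` open in the compact group `Γ_F`, Mathlib
`Subgroup.quotient_finite_of_isOpen`) by permutation matrices on `Fin #Q` (Mathlib `MulAction.toPermHom`,
`Equiv.permCongrHom`, `Matrix.permMatrixHom`; faithful since left multiplication is and a permutation matrix
determines the permutation, `PEquiv.toMatrix_injective`), composed with `Γ_F → Q` (continuous: `Q` is discrete,
Mathlib `QuotientGroup.discreteTopology`, `QuotientGroup.continuous_mk`).  Same construction as the tree's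
`absoluteGaloisGroup.exists_framedArtinRep_restrictNormalHom_eq` for `Gal(E/K)`. [folklore] -/
theorem exists_framedArtinRep_apply_eq_iff {F : Type} [Field F] [NumberField F]
    (N : Subgroup (absoluteGaloisGroup F)) [N.Normal] (hN : IsOpen (N : Set (absoluteGaloisGroup F))) :
    ∃ (n : ℕ) (σ : FramedArtinRep F n), ∀ φ g : absoluteGaloisGroup F, σ φ = σ g ↔ g⁻¹ * φ ∈ N := by
  classical
  haveI : Finite (absoluteGaloisGroup F ⧸ N) := Subgroup.quotient_finite_of_isOpen N hN
  letI : Fintype (absoluteGaloisGroup F ⧸ N) := Fintype.ofFinite _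
  haveI : DiscreteTopology (absoluteGaloisGroup F ⧸ N) := QuotientGroup.discreteTopology hN
  -- the regular permutation representation `π` of `Q = Γ_F ⧸ N` on `Fin #Q`, faithful
  let e := Fintype.equivFin (absoluteGaloisGroup F ⧸ N)
  let π : (absoluteGaloisGroup F ⧸ N) →* GL (Fin (Fintype.card (absoluteGaloisGroup F ⧸ N))) ℂ :=
    ((Matrix.permMatrixHom (R := ℂ)).comp
      (e.permCongrHom.toMonoidHom.comp
        (MulAction.toPermHom (absoluteGaloisGroup F ⧸ N) (absoluteGaloisGroup F ⧸ N)))).toHomUnits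
  have hπ : Function.Injective π := by
    intro g h hgh
    have h1 := congrArg Units.val hgh
    simp only [π, MonoidHom.coe_toHomUnits, MonoidHom.coe_comp, Function.comp_apply,
      Matrix.permMatrixHom_apply, MulEquiv.coe_toMonoidHom] at h1
    have h2 := PEquiv.toMatrix_injective h1
    have h3 : e.permCongrHom (MulAction.toPermHom _ _ g) =
        e.permCongrHom (MulAction.toPermHom _ _ h) := by
      refine inv_injective (Equiv.ext fun x ↦ ?_)
      have hx := congrArg (fun f : PEquiv _ _ ↦ f x) h2
      simpa only [Equiv.toPEquiv_apply, Option.some.injEq] using hx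
    exact MulAction.toPerm_injective (e.permCongrHom.injective h3)
  -- inflate along the continuous projection `Γ_F → Q` (discrete target)
  let r : absoluteGaloisGroup F →* absoluteGaloisGroup F ⧸ N := QuotientGroup.mk' N
  have hr : Continuous r := QuotientGroup.continuous_mk
  have hρ : Continuous (π.comp r) := (continuous_of_discreteTopology (f := π)).comp hr
  refine ⟨_, ⟨π.comp r, hρ⟩, fun φ g ↦ ?_⟩
  change π (r φ) = π (r g) ↔ _
  rw [hπ.eq_iff, eq_comm]
  exact QuotientGroup.eq

/-! ### The Čebotarev window is stable under conjugation -/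

section Window

variable {F : Type} [Field F] (p : ℕ) [Fact p.Prime]
  {O : ValuationSubring (PadicAlgCl p)} (ρ₀ : absoluteGaloisGroup F →* GL (Fin 2) O)

/-- `ρ₀ x ≡ 1 (mod 𝔪_O)` entrywise iff the reduction of the matrix `ρ₀ x` modulo `𝔪_O` is `1`. [folklore] -/
theorem resTrivial_iff (x : absoluteGaloisGroup F) :
    ResTrivial p ρ₀ x ↔
      (ρ₀ x).val.map (Ideal.Quotient.mk (IsLocalRing.maximalIdeal O)) = 1 := by
  rw [← Matrix.map_one (Ideal.Quotient.mk (IsLocalRing.maximalIdeal O)) (map_zero _) (map_one _),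
    ← Matrix.ext_iff]
  simp only [Matrix.map_apply, Ideal.Quotient.eq]
  rfl

/-- Residual triviality is conjugation invariant: `ρ₀ (γ x γ⁻¹) - 1 = ρ₀ γ (ρ₀ x - 1) (ρ₀ γ)⁻¹` has entries
in `𝔪_O` when `ρ₀ x - 1` does (reduce modulo `𝔪_O`). [folklore] -/
theorem resTrivial_conj {x : absoluteGaloisGroup F} (hx : ResTrivial p ρ₀ x) (γ : absoluteGaloisGroup F) :
    ResTrivial p ρ₀ (γ * x * γ⁻¹) := by
  rw [resTrivial_iff] at hx ⊢
  have h1 : (ρ₀ γ).val.map (Ideal.Quotient.mk (IsLocalRing.maximalIdeal O)) *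
      (ρ₀ γ⁻¹).val.map (Ideal.Quotient.mk (IsLocalRing.maximalIdeal O)) = 1 := by
    rw [← Matrix.map_mul, ← Units.val_mul, ← map_mul, mul_inv_cancel, map_one, Units.val_one,
      Matrix.map_one _ (map_zero _) (map_one _)]
  rw [map_mul, map_mul, Units.val_mul, Units.val_mul, Matrix.map_mul, Matrix.map_mul, hx, mul_one, h1]

end Window

/-! ### The stub -/

/-- **Stub S1 `stub_chebotarevSupply`: a thin set of Frobenius conditions is avoidable by a Taylor–Steinberg
place** (Čebotarev).  For `ρ` unramified almost everywhere, an integral model `ρ₀` and a thin `B` (relative to the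
window `G₀ = {τ | ρ₀ τ ≡ 1 (𝔪_O), χ_p τ ≡ 1 (p)}`, with open normal `N ≤ G₀` and a coset `τ N` missing `B`): there
is `v₀ ∤ p` with `ρ` unramified at `v₀`, `N v₀ ≡ 1 (mod p)`, `ρ₀(Frob) ≡ 1 (mod 𝔪_O)` for all Frobenii at
`v₀`, all of which avoid `B`.  Proof: Chebotarev (`chebotarev_artinRep_holds`, Tate GCFT §2.4) for the regular
Artin representation of `Γ_F ⧸ N` (`exists_framedArtinRep_apply_eq_iff`) and the class of `τ` supplies, off the
finite set `{v ∣ p} ∪ ram(ρ)`, a place `v₀` unramified for `Γ_F ⧸ N` with a Frobenius in `τ N`; all Frobenii at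
`v₀` are conjugate into `τ N · I ⊆` conjugates of `τ N` (`exists_smul_eq_of_mem_primesAbove_holds`,
`IsArithFrobAt.conj`, `IsArithFrobAt.mul_inv_mem_inertia`, inertia `⊆ ker = N`), hence are residually
trivial (`τ N ⊆ G₀`, `resTrivial_conj`) and lie outside the conjugation-stable `B`; `N v₀ ≡ 1 (mod p)` is `χ_p(Frob_{v₀}) = N v₀` (`GaloisRep.cyclotomicCharacter_apply_of_isArithFrobAt`,
Serre I §1.2) read modulo `p` (`PadicInt.ker_toZMod`).
[cite: TateGCFT1967, Ch. VII §2.4 (Tchebotarev density theorem)] [cite: SerreAbelianLadic1968, Ch. I §2.2, Cor. 2 (a)] -/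
theorem stub_chebotarevSupply :
    ∀ (F : Type) [Field F] [NumberField F], IsTotallyComplex F → Module.finrank ℚ F = 2 →
      ∀ (p : ℕ) [Fact p.Prime], p ≠ 2 →
      ∀ (O : ValuationSubring (PadicAlgCl p)),
        O = (Valued.v : Valuation (PadicAlgCl p) NNReal).valuationSubring →
      ∀ (ρ : FramedGaloisRep F (PadicAlgCl p) 2) (ρ₀ : absoluteGaloisGroup F →* GL (Fin 2) O),
        ρ.toGaloisRep.IsIrreducible → (∀ᶠ v in cofinite, ρ.IsUnramifiedAt v) →
        ρ.HasUpperTriangularIntegralModel ρ₀ → OrdLoc p O ρ ρ₀ →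
        ∀ B : Set (absoluteGaloisGroup F), IsThin p ρ₀ B →
          ∃ v₀ : HeightOneSpectrum (𝓞 F), TaylorSteinbergPlace p ρ ρ₀ v₀ ∧ FrobAvoids B v₀ := by
  intro F _ _ _ _ p _ _ O _ ρ ρ₀ _ hunr _ _ B hB
  obtain ⟨G₀, N, hG₀, hNn, hNo, hNG₀, -, hBconj, τ, hτG₀, hτB⟩ := hB
  -- the window, read through `G₀`
  have hwin : ∀ x ∈ G₀, ResTrivial p ρ₀ x ∧ CycloTrivialModP p x := fun x hx ↦ by
    have hx' : x ∈ (G₀ : Set (absoluteGaloisGroup F)) := hx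
    rw [hG₀] at hx'
    exact hx'
  -- Step 1: an Artin representation with kernel exactly `N`
  obtain ⟨n, σN, hσN⟩ := exists_framedArtinRep_apply_eq_iff N hNo
  have hker : ∀ x : absoluteGaloisGroup F, σN x = 1 → x ∈ N := fun x hx ↦ by
    have h := (hσN x 1).1 (by rw [hx, map_one])
    simpa using h
  -- Step 2: Chebotarev for `σN` and the class of `τ`, off the finite set `{v ∣ p} ∪ ram(ρ)`
  have hS : ({v : HeightOneSpectrum (𝓞 F) | (p : 𝓞 F) ∈ v.asIdeal} ∪
      {v | ¬ ρ.IsUnramifiedAt v}).Finite := by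
    refine Set.Finite.union ?_ (Filter.eventually_cofinite.1 hunr)
    have hp0 : (Ideal.span {(p : 𝓞 F)} : Ideal (𝓞 F)) ≠ ⊥ := by
      rw [Ne, Ideal.span_singleton_eq_bot]
      exact_mod_cast (Fact.out : p.Prime).ne_zero
    exact (Ideal.finite_factors hp0).subset fun v hv ↦ Ideal.dvd_span_singleton.2 hv
  obtain ⟨v₀, ⟨hσNv₀, 𝔓₀, h𝔓₀, φ, hφ, hφτ⟩, hv₀S⟩ :=
    ((chebotarev_artinRep_holds F n σN τ).sdiff hS).nonempty
  have hpv₀ : (p : 𝓞 F) ∉ v₀.asIdeal := fun h ↦ hv₀S (Or.inl h)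
  have hρv₀ : ρ.IsUnramifiedAt v₀ := by
    by_contra h
    exact hv₀S (Or.inr h)
  -- `φ ∈ τ N`
  have hφN : τ⁻¹ * φ ∈ N := (hσN φ τ).1 hφτ
  have hφG₀ : φ ∈ G₀ := by
    have h := G₀.mul_mem hτG₀ (hNG₀ hφN)
    rwa [mul_inv_cancel_left] at h
  -- Step 3: every arithmetic Frobenius at every prime above `v₀` is conjugate into `τ N`
  have key : ∀ 𝔓 ∈ v₀.primesAbove, ∀ σ : absoluteGaloisGroup F, IsArithFrobAt (𝓞 F) σ 𝔓 →
      ∃ γ : absoluteGaloisGroup F, ∃ n' ∈ N, σ = γ * (τ * n') * γ⁻¹ := by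
    intro 𝔓 h𝔓 σ hσ
    obtain ⟨γ, rfl⟩ := HeightOneSpectrum.exists_smul_eq_of_mem_primesAbove_holds h𝔓₀ h𝔓
    -- `γ φ γ⁻¹` is a Frobenius at `γ • 𝔓₀`, so `σ (γ φ γ⁻¹)⁻¹ ∈ I_{γ • 𝔓₀} ⊆ ker σN = N`
    have hiN : σ * (γ * φ * γ⁻¹)⁻¹ ∈ N :=
      hker _ (hσNv₀ _ h𝔓 _ (hσ.mul_inv_mem_inertia (hφ.conj γ)))
    refine ⟨γ, τ⁻¹ * (γ⁻¹ * (σ * (γ * φ * γ⁻¹)⁻¹) * γ⁻¹⁻¹) * τ⁻¹⁻¹ * (τ⁻¹ * φ), ?_, ?_⟩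
    · exact N.mul_mem (hNn.conj_mem _ (hNn.conj_mem _ hiN γ⁻¹) τ⁻¹) hφN
    · group
  -- Step 4 (b): `N v₀ ≡ 1 (mod p)` from `χ_p(φ) ≡ 1 (mod p)` and `χ_p(φ) = N v₀`
  have hnorm : Ideal.absNorm v₀.asIdeal ≡ 1 [MOD p] := by
    have hc : ((GaloisRep.cyclotomicCharacter F p φ : ℤ_[p]ˣ) : ℤ_[p]) - 1 ∈
        IsLocalRing.maximalIdeal ℤ_[p] := (hwin φ hφG₀).2
    rw [GaloisRep.cyclotomicCharacter_apply_of_isArithFrobAt hpv₀ h𝔓₀ hφ, ← PadicInt.ker_toZMod,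
      RingHom.mem_ker, map_sub, map_natCast, map_one, sub_eq_zero] at hc
    rw [← ZMod.natCast_eq_natCast_iff, Nat.cast_one]
    exact hc
  -- Step 5: assemble
  refine ⟨v₀, ⟨hpv₀, hρv₀, hnorm, fun 𝔓 h𝔓 σ hσ ↦ ?_⟩, fun 𝔓 h𝔓 σ hσ hσB ↦ ?_⟩
  · obtain ⟨γ, n', hn', rfl⟩ := key 𝔓 h𝔓 σ hσ
    exact resTrivial_conj p ρ₀ (hwin _ (G₀.mul_mem hτG₀ (hNG₀ hn'))).1 γ
  · obtain ⟨γ, n', hn', rfl⟩ := key 𝔓 h𝔓 σ hσ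
    have h := hBconj γ⁻¹ _ hσB
    rw [show γ⁻¹ * (γ * (τ * n') * γ⁻¹) * γ⁻¹⁻¹ = τ * n' by group] at h
    exact hτB n' hn' h

end

end Summit.Langlands.Langlands.Cruxes.ReducibleOrdinaryProModular.SteinbergHyperplane
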